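import Summits.AnomalousDissipation.AnomalousDissipation.Theorems.SolenoidalFractalHomogenisationLagrangianStepFrameModulation
import Summits.AnomalousDissipation.AnomalousDissipation.Theorems.SolenoidalFractalHomogenisationLagrangianStepFrameNearIdentity
import Summits.AnomalousDissipation.AnomalousDissipation.Theorems.SolenoidalFractalHomogenisationLagrangianStepFrameRate
import Literature.Analysis.FunctionSpaces.TorusPiola

/-!
# K1L_D (stmt-AnomalousDissipation-27980), glue v2 / L5-0: `isModulation_frameG` — the exact-flow frame is a modulation with
# `θ = Cα·strain m`, ALL window inputs discharged except the sharp curvature (K8-5) (helper, `--supports 27980 --as helper`)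

prover ad-k1loc-p3 g8.  Assembles `FrameForm.isModulation_frameG_of` (p695470) with its window inputs BY NAME:
* `hpiola` ← `isDivFree_frameG_col`: the columns of `frameG = adj ∇X` are divergence free on the window — Piola's identity on the torus
  (`Literature.Analysis.FunctionSpaces.Torus.isDivFree_adjugate_col`, this seat's Literature file) applied to the smooth displacement
  `D = disp m (jR+u) (jR)` (`frameJac_{ac} = δ_{ac} + ∂_c D_a`, `LevelRegular.flowDeriv_single_apply`; `frameG = adj frameJac`, `frameG_eq_adjugate`);
* `hnear` ← `abs_frameG_sub_one_le_strain` (p696381), `hrate` ← `abs_partialDeriv_partialSum_le` (p696685), `hbudget` by arithmetic;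
so that **`isModulation_frameG`** reads: for every design `W` there are `θs > 0`, `Cα ≥ 0` (depending on `k, W`) such that for every
`LPermissible`, `Regular` carrier of design `W` with `N_m² ≤ N_{m+1}`, the template (T4) at `θ₀ ≤ θs`, every level `m`, window index `j`, piece end
`t ∈ window (m+1) j` with `jR < t`, and every `nC`, the SHARP CURVATURE hypothesis `|∂_c (frameG)_{il}| ≤ (Cα·strain m)·nC` on the window (K8-5,
memo L12 §5(iii)) ALONE gives `CellClauseMod.IsModulation (Cα·strain m) (a (m+1)·(t − jR)) nC (fun τ y => frameG E m (jR + τ/a (m+1)) (jR) y)`.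
No sorry, no definition, no named fact.  NOT a proof of (V_mod), of `stub_cellInputs`, of K1L_D or of AD; rung F-D1.A0.
-/

set_option linter.dupNamespace false

noncomputable section

namespace Summit.AnomalousDissipation.AnomalousDissipation.Theorems.SolenoidalFractalHomogenisation.LagrangianStep.FrameForm

open Set Function Filter MeasureTheory
open scoped NNReal
open Literature.Analysis Literature.Analysis.ODE Literature.Analysis.FunctionSpaces Literature.Analysis.FunctionSpaces.Torus
open Literature.Analysis.FluidPDE Literature.Analysis.FluidPDE.LatticeShear
open Summit.AnomalousDissipation.AnomalousDissipation.Theorems.SolenoidalFractalHomogenisation.LagrangianCarrierConstruction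
open Summit.AnomalousDissipation.AnomalousDissipation.Theorems.SolenoidalFractalHomogenisation.LagrangianCarrier

variable {k : ℕ}

/-- **The columns of the inverse frame are divergence free on a refresh window** (Piola; the `hpiola` input of
`isModulation_frameG_of`). [folklore] -/
theorem isDivFree_frameG_col (E : LagrangianLatticeCarrier k) (hR : E.LevelRegular) {m : ℕ} (hF : E.IsFlow m) (j : ℤ) {T : ℝ}
    (hT : T < E.refresh (m + 1)) {u : ℝ} (hu : u ∈ Icc 0 T) (i : Fin 3) :
    Torus.IsDivFree (fun y => (WithLp.toLp 2 fun c =>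
      frameG E m ((j : ℝ) * E.refresh (m + 1) + u) ((j : ℝ) * E.refresh (m + 1)) y c i : EuclideanSpace ℝ (Fin 3))) := by
  have hD : Torus.IsSmooth (E.disp m ((j : ℝ) * E.refresh (m + 1) + u) ((j : ℝ) * E.refresh (m + 1))) := hR.isSmooth_disp m _ _
  have h := Torus.isDivFree_adjugate_col hD i
  have e : (fun y => (WithLp.toLp 2 fun c =>
      frameG E m ((j : ℝ) * E.refresh (m + 1) + u) ((j : ℝ) * E.refresh (m + 1)) y c i : EuclideanSpace ℝ (Fin 3))) =
      fun y => WithLp.toLp 2 fun c => (Matrix.of fun a c' => (1 : Matrix (Fin 3) (Fin 3) ℝ) a c' +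
        Torus.partialDeriv c' (fun w => E.disp m ((j : ℝ) * E.refresh (m + 1) + u) ((j : ℝ) * E.refresh (m + 1)) w a) y).adjugate c i := by
    funext y
    rw [frameG_eq_adjugate E hR hF j hT hu y]
    congr 2
    funext c
    congr 2
    ext a c'
    rw [frameJac, Matrix.of_apply, Matrix.of_apply, hR.flowDeriv_single_apply]
  rw [e]
  exact h

/-- **THE EXACT-FLOW FRAME IS A MODULATION with `θ = Cα·strain m`** (L5-0 fields (i)(ii) of memo L12 §5; lead-k1l-onelevel-p1 g5's
`isModulation_frameG`): all window inputs of `isModulation_frameG_of` are discharged from the K3L tower and Piola's identity, except the SHARP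
CURVATURE bound `|∂_c (frameG)_{il}| ≤ (Cα·strain m)·nC` (K8-5), which stays the one hypothesis. [folklore] -/
theorem isModulation_frameG (k : ℕ) (W : LatticeWord k) : ∃ θs : ℝ, 0 < θs ∧ ∃ Cα : ℝ, 0 ≤ Cα ∧
    ∀ (E : LagrangianLatticeCarrier k) (θ₀ : ℝ), E.design = W → θ₀ ≤ θs → E.LPermissible → E.Regular →
      (∀ m, E.N m ^ 2 ≤ E.N (m + 1)) → (∀ m, E.θ (m + 1) * ((E.N (m + 1) : ℝ) / E.N m) ^ (1 / 16 : ℝ) ≤ θ₀) →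
      ∀ (m : ℕ) (j : ℤ) (t : ℝ), t ∈ E.window (m + 1) j → (j : ℝ) * E.refresh (m + 1) < t → ∀ (nC : ℝ),
        (∀ u ∈ Icc 0 (t - (j : ℝ) * E.refresh (m + 1)), ∀ (y : UnitAddTorus (Fin 3)) (i l c : Fin 3),
          |Torus.partialDeriv c (fun y => frameG E m ((j : ℝ) * E.refresh (m + 1) + u) ((j : ℝ) * E.refresh (m + 1)) y i l) y|
            ≤ (Cα * E.strain m) * nC) →
        CellClauseMod.IsModulation (Cα * E.strain m) (E.a (m + 1) * (t - (j : ℝ) * E.refresh (m + 1))) nC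
          (fun τ y => frameG E m ((j : ℝ) * E.refresh (m + 1) + τ / E.a (m + 1)) ((j : ℝ) * E.refresh (m + 1)) y) := by
  obtain ⟨θ₁, hθ₁, C, hC, Hnear⟩ := abs_frameG_sub_one_le_strain k W
  obtain ⟨θ₂, hθ₂, C', hC', Hrate⟩ := abs_partialDeriv_partialSum_le k W
  -- the constant and the ceiling (which also keeps `θ = Cα·strain m ≤ 1`)
  set Cα : ℝ := 5 * C + 6 * C' with hCα
  have hCα0 : 0 ≤ Cα := by rw [hCα]; positivity
  refine ⟨min (min θ₁ θ₂) (1 / (Cα + 1)), lt_min (lt_min hθ₁ hθ₂) (by positivity), Cα, hCα0, ?_⟩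
  intro E θ₀ hD hθs hLP hReg hsq hT4 m j t ht hst nC hcurv
  have hθs₁ : θ₀ ≤ θ₁ := hθs.trans ((min_le_left _ _).trans (min_le_left _ _))
  have hθs₂ : θ₀ ≤ θ₂ := hθs.trans ((min_le_left _ _).trans (min_le_right _ _))
  have hθs₃ : θ₀ ≤ 1 / (Cα + 1) := hθs.trans (min_le_right _ _)
  have hLR := hReg.levelRegular
  have hF : E.IsFlow m := (hLP.isLagrangian m).1
  set s : ℝ := (j : ℝ) * E.refresh (m + 1) with hs
  set S : ℝ := ∑ i ∈ Finset.range m, E.a (i + 1) with hS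
  have hS0 : 0 ≤ S := Finset.sum_nonneg fun i _ => (E.toFractalCarrierData.a_pos _).le
  have hTR : t - s < E.refresh (m + 1) := by
    have := abs_sub_lt_refresh_of_mem_window E (m + 1) j (left_mem_window E (m + 1) j) ht
    exact (le_abs_self _).trans_lt this
  -- `θ = Cα·strain m ≤ 1`
  have hNpos : ∀ m, (0 : ℝ) < E.N m := fun m => by exact_mod_cast E.toFractalCarrierData.N_pos m
  have hN2 : ∀ m, 2 * E.N m ≤ E.N (m + 1) := hLP.permissible.2.2.1
  have hθm : E.θ (m + 1) ≤ θ₀ := by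
    have hNmono : (E.N m : ℝ) ≤ E.N (m + 1) := by
      have h : (2 : ℝ) * E.N m ≤ E.N (m + 1) := by exact_mod_cast hN2 m
      linarith [hNpos m]
    have hr : (1 : ℝ) ≤ ((E.N (m + 1) : ℝ) / E.N m) ^ (1 / 16 : ℝ) :=
      Real.one_le_rpow ((one_le_div (hNpos m)).2 hNmono) (by norm_num)
    calc E.θ (m + 1) = E.θ (m + 1) * 1 := (mul_one _).symm
      _ ≤ E.θ (m + 1) * ((E.N (m + 1) : ℝ) / E.N m) ^ (1 / 16 : ℝ) := mul_le_mul_of_nonneg_left hr (E.θ_pos _).le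
      _ ≤ θ₀ := hT4 m
  have hstrain0 : 0 ≤ E.strain m := by
    have := mul_nonneg hS0 (E.refresh_pos (m + 1)).le
    simpa [LagrangianLatticeCarrier.strain, hS] using this
  have hstrainθ : E.strain m ≤ θ₀ := (hLP.strain_le m).trans hθm
  have hθle1 : Cα * E.strain m ≤ 1 := by
    have h1 : Cα * θ₀ ≤ Cα * (1 / (Cα + 1)) := mul_le_mul_of_nonneg_left hθs₃ hCα0
    have h2 : Cα * (1 / (Cα + 1)) ≤ 1 := by
      rw [mul_one_div, div_le_one (by positivity)]; linarith
    nlinarith [mul_le_mul_of_nonneg_left hstrainθ hCα0]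
  have hθ0 : 0 ≤ Cα * E.strain m := mul_nonneg hCα0 hstrain0
  -- window membership of `s + u` for `u ∈ Icc 0 (t − s)`
  have hwin : ∀ u ∈ Icc 0 (t - s), s + u ∈ E.window (m + 1) j := by
    intro u hu
    refine ⟨by rw [hs]; linarith [hu.1], ?_⟩
    nlinarith [hu.2, ht.2]
  -- hnear
  have hnear : ∀ u ∈ Icc 0 (t - s), ∀ (y : UnitAddTorus (Fin 3)) (i l : Fin 3),
      |frameG E m (s + u) s y i l - (1 : Matrix (Fin 3) (Fin 3) ℝ) i l| ≤ Cα * E.strain m := by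
    intro u hu y i l
    have h := Hnear E θ₀ hD hθs₁ hLP hReg hsq hT4 m j (s + u) (hwin u hu) y i l
    have hsw : S * (s + u - s) ≤ E.strain m := strain_window_le E m j (hwin u hu)
    have h5 : 5 * C * (S * (s + u - (j : ℝ) * E.refresh (m + 1))) ≤ 5 * C * E.strain m := by
      rw [← hs]; exact mul_le_mul_of_nonneg_left hsw (by positivity)
    have h6 : 5 * C * E.strain m ≤ Cα * E.strain m := by
      rw [hCα]; nlinarith [mul_nonneg hC' hstrain0]
    exact h.trans (h5.trans h6)
  -- hrate with `Cb = C'·S`, and the budget `3(1+θ)·Cb·(t−s) ≤ 6 C'·strain ≤ θ`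
  have hrate : ∀ u ∈ Icc 0 (t - s), ∀ (y : UnitAddTorus (Fin 3)) (a q : Fin 3),
      |Torus.partialDeriv q (fun z => E.partialSum m (s + u) z a) (E.X m (s + u) s y)| ≤ C' * S :=
    fun u _ y a q => Hrate E θ₀ hD hθs₂ hLP hReg hsq hT4 m (s + u) _ a q
  have hbudget : 3 * (1 + Cα * E.strain m) * (C' * S) * (t - s) ≤ Cα * E.strain m := by
    have hsw : S * (t - s) ≤ E.strain m := strain_window_le E m j ht
    have h1 : 3 * (1 + Cα * E.strain m) * (C' * S) * (t - s) ≤ 6 * C' * (S * (t - s)) := by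
      have : (1 + Cα * E.strain m) ≤ 2 := by linarith
      have hSt : 0 ≤ S * (t - s) := mul_nonneg hS0 (by linarith)
      nlinarith [mul_nonneg hC' hSt]
    have h2 : 6 * C' * (S * (t - s)) ≤ 6 * C' * E.strain m := mul_le_mul_of_nonneg_left hsw (by positivity)
    have h3 : 6 * C' * E.strain m ≤ Cα * E.strain m := by rw [hCα]; nlinarith [mul_nonneg hC hstrain0]
    linarith
  -- assemble
  exact isModulation_frameG_of E hLR hF j hst hTR hθ0 (mul_nonneg hC' hS0) hnear hrate hbudget
    (fun u hu i => isDivFree_frameG_col E hLR hF j hTR hu i) hcurv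

end Summit.AnomalousDissipation.AnomalousDissipation.Theorems.SolenoidalFractalHomogenisation.LagrangianStep.FrameForm

end
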